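import Summits.QuantumFields.YangMills.Theorems.ColdStartUniversalityLatticeLangevinLocalCarre
import Summits.QuantumFields.YangMills.Theorems.ColdStartUniversalityLatticeLangevinWilsonFrameIBP
import HarnessLib

/-!
# WEIGHTED localisations of the `ρ`-Lipschitz ⇄ carré-du-champ dictionary on `SU(2)^E`: the weighted distance
# `d_w(Q,Q')² = Σ_e w_e ρ(Q_e,Q'_e)²` against the weighted carré du champ `Γ^(1/w)(f) = Σ_n w_(n.1)⁻¹ (W_n f)²`

Seat `ym-line-csu-p1` (g43), route `ColdStartUniversality` of `Summits/QuantumFields/YangMills`, helper file (`--supports stmt-QuantumFields-24809`).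
Weighted twins of G63a (`…LocalCarre`) for a positive link weight `w`: the metric `d_w` (Shen–Zhu–Zhu's `ρ_(∞,a)` restricted to a torus has
this form, with `w_e` the sum of `a^(−|ẽ|)` over the lifts `ẽ` of `e`) is dual to the carré du champ with the INVERSE weights.
* `noiseVec_coords_eq_rho` — the noise frame vector read through `rebuild ∘ coords` equals its `ρ`-form (dictionary between the two spellings);
* `riemannDist_expSU_mul_sq_le` — one link moves by at most `|s|·|X|` under `e^(sX)`;
* ★ `frame_cauchySchwarz_two_weighted` — `Λ(X·V)² ≤ (Σ_e w_e|X_e|²/2)·Σ_n w_(n.1)⁻¹ Λ(σ_n)²`;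
* ★★ `abs_sub_le_of_wcarre_le_on_ball` — `Γ^(1/w)(f) ≤ σ²` on `{d_w(Q,·) ≤ d_w(Q,Q')}` ⇒ `|f(coords Q') − f(coords Q)| ≤ √(σ²/2)·d_w(Q,Q')`;
* ★★ `wcarre_le_two_mul_sq_of_local_wlipschitz` — `|f(coords Q') − f(coords V)| ≤ L·d_w(V,Q')` for `d_w(V,Q') < δ` ⇒ `Γ^(1/w)(f)(V) ≤ 2L²`.
THEOREMS ONLY, no definition, no sorry.  HONEST FRAMING: fixed cut-off; pure Riemannian calculus on `SU(2)^E`; nothing `K`-uniform; no crux,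
rung or summit statement is proved; the Yang–Mills mass gap is NOT proved.
-/

set_option autoImplicit false

noncomputable section

namespace Summit.QuantumFields.YangMills.Theorems.ColdStartUniversality

open MeasureTheory ProbabilityTheory Matrix Complex Finset Filter Topology Set Metric
open scoped ComplexConjugate BigOperators Real NNReal
open Literature.MathematicalPhysics.QuantumFieldTheory
open Literature.MathematicalPhysics.QuantumLattice (fundamentalRep fundamentalLatticeRep continuous_fundamentalRep fundamentalRep_apply fundamentalLatticeRep_N)

variable {L : ℕ} [NeZero L]

section Local

open scoped Matrix.Norms.Operator

omit [NeZero L] in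
/-- The noise frame vector `σ_n` written through `rebuild ∘ coords` is its `ρ`-form (`rebuild (coords V) = (V_e)_e`). [folklore] -/
theorem noiseVec_coords_eq_rho (n : Edge 3 L × NoiseIdx (fundamentalLatticeRep 2).N) (V : GaugeConfig 3 L (Matrix.specialUnitaryGroup (Fin 2) ℂ)) :
    (fun q : Edge 3 L × Fin (fundamentalLatticeRep 2).N × Fin (fundamentalLatticeRep 2).N × Bool => if n.1 = q.1 then (fun z : ℂ => if q.2.2.2 then z.im else z.re) (((Real.sqrt 2 : ℂ) • ((fundamentalLatticeRep 2).lieProj (noiseDir n.2) * (fun (ee : Edge 3 L) => Matrix.of fun (i j : Fin (fundamentalLatticeRep 2).N) => (((fun (V : GaugeConfig 3 L (Matrix.specialUnitaryGroup (Fin 2) ℂ)) (q : Edge 3 L × Fin (fundamentalLatticeRep 2).N × Fin (fundamentalLatticeRep 2).N × Bool) => (fun z : ℂ => if q.2.2.2 then z.im else z.re) ((fundamentalRep (Fin 2) (V q.1) : Matrix (Fin 2) (Fin 2) ℂ) q.2.1 q.2.2.1)) V (ee, i, j, false) : ℝ) : ℂ) + (((fun (V : GaugeConfig 3 L (Matrix.specialUnitaryGroup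 (Fin 2) ℂ)) (q : Edge 3 L × Fin (fundamentalLatticeRep 2).N × Fin (fundamentalLatticeRep 2).N × Bool) => (fun z : ℂ => if q.2.2.2 then z.im else z.re) ((fundamentalRep (Fin 2) (V q.1) : Matrix (Fin 2) (Fin 2) ℂ) q.2.1 q.2.2.1)) V (ee, i, j, true) : ℝ) : ℂ) * Complex.I) q.1)) q.2.1 q.2.2.1) else 0) = (fun q : Edge 3 L × Fin (fundamentalLatticeRep 2).N × Fin (fundamentalLatticeRep 2).N × Bool => if n.1 = q.1 then (fun z : ℂ => if q.2.2.2 then z.im else z.re) (((Real.sqrt 2 : ℂ) • ((fundamentalLatticeRep 2).lieProj (noiseDir n.2) * (fundamentalLatticeRep 2).ρ (V q.1))) q.2.1 q.2.2.1) else 0) := by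
  rw [rebuild_coords_of V]
  rfl

omit [NeZero L] in
/-- One link moves by at most `|s|·|X|`: `ρ(V_e, e^(sX) V_e)² ≤ s²·|X|²` for `X ∈ 𝔰𝔲(2)` (`sX` is a logarithm). [cite: GallotHulinLafontaine2004, 2.91] -/
theorem riemannDist_expSU_mul_sq_le (g : Matrix.specialUnitaryGroup (Fin 2) ℂ) {X : Matrix (Fin (fundamentalLatticeRep 2).N) (Fin (fundamentalLatticeRep 2).N) ℂ}
    (hXmem : X ∈ (fundamentalLatticeRep 2).lieAlg) (hXh : Xᴴ = -X) (hX0 : X.trace = 0) (s : ℝ) :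
    (fundamentalLatticeRep 2).riemannDist g (SUNBakryEmery.expSU (N := 2) (Y := Matrix.of fun i j : Fin 2 => X i j) hXh hX0 s * g) ^ 2 ≤
      s ^ 2 * hsForm (fundamentalLatticeRep 2).N X X := by
  have hmem : (s • X) ∈ (fundamentalLatticeRep 2).lieAlg := (fundamentalLatticeRep 2).lieAlg.smul_mem _ hXmem
  have hexp : NormedSpace.exp (s • X) * (fundamentalLatticeRep 2).ρ g =
      (fundamentalLatticeRep 2).ρ (SUNBakryEmery.expSU (N := 2) (Y := Matrix.of fun i j : Fin 2 => X i j) hXh hX0 s * g) := rfl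
  have hle : (fundamentalLatticeRep 2).riemannDist g (SUNBakryEmery.expSU (N := 2) (Y := Matrix.of fun i j : Fin 2 => X i j) hXh hX0 s * g) ≤
      Real.sqrt (hsForm (fundamentalLatticeRep 2).N (s • X) (s • X)) := by
    rw [LatticeRep.riemannDist]
    refine csInf_le ⟨0, ?_⟩ ⟨s • X, ⟨hmem, hexp⟩, rfl⟩
    rintro _ ⟨Y, -, rfl⟩; exact Real.sqrt_nonneg _
  have hs : hsForm (fundamentalLatticeRep 2).N (s • X) (s • X) = s ^ 2 * hsForm (fundamentalLatticeRep 2).N X X := by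
    rw [hsForm_real_smul_left, hsForm_comm, hsForm_real_smul_left]; ring
  have h0 := (fundamentalLatticeRep 2).riemannDist_nonneg g (SUNBakryEmery.expSU (N := 2) (Y := Matrix.of fun i j : Fin 2 => X i j) hXh hX0 s * g)
  calc (fundamentalLatticeRep 2).riemannDist g (SUNBakryEmery.expSU (N := 2) (Y := Matrix.of fun i j : Fin 2 => X i j) hXh hX0 s * g) ^ 2
      ≤ Real.sqrt (hsForm (fundamentalLatticeRep 2).N (s • X) (s • X)) ^ 2 := pow_le_pow_left₀ h0 hle 2
    _ = s ^ 2 * hsForm (fundamentalLatticeRep 2).N X X := by rw [Real.sq_sqrt (hsForm_self_nonneg _), hs]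

/-- ★ **Weighted Cauchy–Schwarz along the noise frame**: for a positive link weight `w`, `X ∈ 𝔰𝔲(2)^E` and every linear functional `Λ`,
`Λ((X_e V_e)_e)² ≤ (Σ_e w_e|X_e|²/2)·Σ_n w_(n.1)⁻¹·Λ(σ_n(V))²` (the unweighted G42 §1 applied to `(√w_e X_e)_e` and `Λ` precomposed with the
blockwise scaling by `1/√w_e`). [folklore] -/
theorem frame_cauchySchwarz_two_weighted (V : GaugeConfig 3 L (Matrix.specialUnitaryGroup (Fin 2) ℂ)) (X : Edge 3 L → Matrix (Fin (fundamentalLatticeRep 2).N) (Fin (fundamentalLatticeRep 2).N) ℂ)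
    (hX : ∀ e, X e ∈ (fundamentalLatticeRep 2).lieAlg) (w : Edge 3 L → ℝ) (hw : ∀ e, 0 < w e) (Λ : (Edge 3 L × Fin (fundamentalLatticeRep 2).N × Fin (fundamentalLatticeRep 2).N × Bool → ℝ) →L[ℝ] ℝ) :
    (Λ (fun q : Edge 3 L × Fin (fundamentalLatticeRep 2).N × Fin (fundamentalLatticeRep 2).N × Bool => (fun z : ℂ => if q.2.2.2 then z.im else z.re) ((X q.1 * (fundamentalLatticeRep 2).ρ (V q.1)) q.2.1 q.2.2.1))) ^ 2 ≤
      (∑ e : Edge 3 L, w e * hsForm (fundamentalLatticeRep 2).N (X e) (X e)) / 2 *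
        ∑ n : Edge 3 L × NoiseIdx (fundamentalLatticeRep 2).N, (w n.1)⁻¹ * (Λ (fun q : Edge 3 L × Fin (fundamentalLatticeRep 2).N × Fin (fundamentalLatticeRep 2).N × Bool => if n.1 = q.1 then (fun z : ℂ => if q.2.2.2 then z.im else z.re) (((Real.sqrt 2 : ℂ) • ((fundamentalLatticeRep 2).lieProj (noiseDir n.2) * (fundamentalLatticeRep 2).ρ (V q.1))) q.2.1 q.2.2.1) else 0)) ^ 2 := by
  classical
  -- the blockwise scaling `D y (e,·) = y (e,·)/√w_e` as a continuous linear map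
  let Dl : (Edge 3 L × Fin (fundamentalLatticeRep 2).N × Fin (fundamentalLatticeRep 2).N × Bool → ℝ) →ₗ[ℝ] (Edge 3 L × Fin (fundamentalLatticeRep 2).N × Fin (fundamentalLatticeRep 2).N × Bool → ℝ) :=
    { toFun := fun y q => (Real.sqrt (w q.1))⁻¹ * y q
      map_add' := fun y y' => by funext q; simp only [Pi.add_apply]; ring
      map_smul' := fun a y => by funext q; simp only [Pi.smul_apply, smul_eq_mul, RingHom.id_apply]; ring }
  let D : (Edge 3 L × Fin (fundamentalLatticeRep 2).N × Fin (fundamentalLatticeRep 2).N × Bool → ℝ) →L[ℝ] (Edge 3 L × Fin (fundamentalLatticeRep 2).N × Fin (fundamentalLatticeRep 2).N × Bool → ℝ) := LinearMap.toContinuousLinearMap Dl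
  have hD : ∀ y q, D y q = (Real.sqrt (w q.1))⁻¹ * y q := fun y q => rfl
  -- the rescaled direction `X'_e = √w_e X_e`
  set X' : Edge 3 L → Matrix (Fin (fundamentalLatticeRep 2).N) (Fin (fundamentalLatticeRep 2).N) ℂ := fun e => (Real.sqrt (w e) : ℂ) • X e with hX'
  have hX'mem : ∀ e, X' e ∈ (fundamentalLatticeRep 2).lieAlg := fun e => by
    have h : X' e = Real.sqrt (w e) • X e := by
      rw [hX']; ext i j; simp only [Matrix.smul_apply, Complex.real_smul, smul_eq_mul]
    rw [h]; exact (fundamentalLatticeRep 2).lieAlg.smul_mem _ (hX e)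
  have hsq : ∀ e, Real.sqrt (w e) ^ 2 = w e := fun e => Real.sq_sqrt (hw e).le
  have hsw : ∀ e, (Real.sqrt (w e))⁻¹ * Real.sqrt (w e) = 1 := fun e => inv_mul_cancel₀ (Real.sqrt_pos.2 (hw e)).ne'
  -- `D (X'·V) = X·V`
  have hv : D (fun q : Edge 3 L × Fin (fundamentalLatticeRep 2).N × Fin (fundamentalLatticeRep 2).N × Bool => (fun z : ℂ => if q.2.2.2 then z.im else z.re) ((X' q.1 * (fundamentalLatticeRep 2).ρ (V q.1)) q.2.1 q.2.2.1)) =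
      fun q : Edge 3 L × Fin (fundamentalLatticeRep 2).N × Fin (fundamentalLatticeRep 2).N × Bool => (fun z : ℂ => if q.2.2.2 then z.im else z.re) ((X q.1 * (fundamentalLatticeRep 2).ρ (V q.1)) q.2.1 q.2.2.1) := by
    funext q
    rw [hD, hX']
    dsimp only
    rw [Matrix.smul_mul, Matrix.smul_apply]
    obtain ⟨e, i, j, b⟩ := q
    cases b
    · simp only [Bool.false_eq_true, if_false, smul_eq_mul, Complex.re_ofReal_mul]
      exact inv_mul_cancel_left₀ (Real.sqrt_pos.2 (hw e)).ne' _
    · simp only [if_true, smul_eq_mul, Complex.im_ofReal_mul]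
      exact inv_mul_cancel_left₀ (Real.sqrt_pos.2 (hw e)).ne' _
  -- `D σ_n = σ_n/√w_(n.1)`
  have hσ : ∀ n : Edge 3 L × NoiseIdx (fundamentalLatticeRep 2).N, D (fun q : Edge 3 L × Fin (fundamentalLatticeRep 2).N × Fin (fundamentalLatticeRep 2).N × Bool => if n.1 = q.1 then (fun z : ℂ => if q.2.2.2 then z.im else z.re) (((Real.sqrt 2 : ℂ) • ((fundamentalLatticeRep 2).lieProj (noiseDir n.2) * (fundamentalLatticeRep 2).ρ (V q.1))) q.2.1 q.2.2.1) else 0) = (Real.sqrt (w n.1))⁻¹ • (fun q : Edge 3 L × Fin (fundamentalLatticeRep 2).N × Fin (fundamentalLatticeRep 2).N × Bool => if n.1 = q.1 then (fun z : ℂ => if q.2.2.2 then z.im else z.re) (((Real.sqrt 2 : ℂ) • ((fundamentalLatticeRep 2).lieProj (noiseDir n.2) * (fundamentalLatticeRep 2).ρ (V q.1))) q.2.1 q.2.2.1) else 0) := by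
    intro n; funext q
    rw [hD, Pi.smul_apply, smul_eq_mul]
    by_cases h : n.1 = q.1
    · rw [if_pos h, h]
    · rw [if_neg h, mul_zero, mul_zero]
  have h := frame_cauchySchwarz_two V X' hX'mem (Λ.comp D)
  simp only [ContinuousLinearMap.comp_apply, hv, hσ, map_smul, smul_eq_mul] at h
  have hnorm : ∑ e : Edge 3 L, hsForm (fundamentalLatticeRep 2).N (X' e) (X' e) = ∑ e : Edge 3 L, w e * hsForm (fundamentalLatticeRep 2).N (X e) (X e) :=
    Finset.sum_congr rfl fun e _ => by
      rw [hX']; dsimp only; rw [hsForm_coe_smul_left, hsForm_coe_smul_right, ← mul_assoc, ← sq, hsq]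
  have hterm : ∀ n : Edge 3 L × NoiseIdx (fundamentalLatticeRep 2).N, ((Real.sqrt (w n.1))⁻¹ * Λ (fun q : Edge 3 L × Fin (fundamentalLatticeRep 2).N × Fin (fundamentalLatticeRep 2).N × Bool => if n.1 = q.1 then (fun z : ℂ => if q.2.2.2 then z.im else z.re) (((Real.sqrt 2 : ℂ) • ((fundamentalLatticeRep 2).lieProj (noiseDir n.2) * (fundamentalLatticeRep 2).ρ (V q.1))) q.2.1 q.2.2.1) else 0)) ^ 2 = (w n.1)⁻¹ * (Λ (fun q : Edge 3 L × Fin (fundamentalLatticeRep 2).N × Fin (fundamentalLatticeRep 2).N × Bool => if n.1 = q.1 then (fun z : ℂ => if q.2.2.2 then z.im else z.re) (((Real.sqrt 2 : ℂ) • ((fundamentalLatticeRep 2).lieProj (noiseDir n.2) * (fundamentalLatticeRep 2).ρ (V q.1))) q.2.1 q.2.2.1) else 0)) ^ 2 := fun n => by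
    rw [mul_pow, inv_pow, hsq]
  rw [hnorm] at h
  simp only [hterm] at h
  exact h

/-- ★★ **Weighted localised G42.**  Let `w > 0` be a link weight and `f` differentiable with `Γ^(1/w)(f)(y) ≤ σ²` for every `y` with
`d_w(Q,y) ≤ d_w(Q,Q')`.  Then `|f(coords Q') − f(coords Q)| ≤ √(σ²/2)·d_w(Q,Q')` (mean value inequality along the minimal product geodesic,
which stays in that `d_w`-ball; weighted Cauchy–Schwarz). [cite: BakryGentilLedoux2014, §1.11 and (3.2.4)] -/
theorem abs_sub_le_of_wcarre_le_on_ball (Q Q' : GaugeConfig 3 L (Matrix.specialUnitaryGroup (Fin 2) ℂ)) (w : Edge 3 L → ℝ) (hw : ∀ e, 0 < w e)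
    {f : (Edge 3 L × Fin 2 × Fin 2 × Bool → ℝ) → ℝ} (hf : Differentiable ℝ f) {σ2 : ℝ} :
    let coords : GaugeConfig 3 L (Matrix.specialUnitaryGroup (Fin 2) ℂ) → (Edge 3 L × Fin 2 × Fin 2 × Bool → ℝ) :=
      fun V q => (fun z : ℂ => if q.2.2.2 then z.im else z.re)
        ((fundamentalRep (Fin 2) (V q.1) : Matrix (Fin 2) (Fin 2) ℂ) q.2.1 q.2.2.1)
    (∀ y : GaugeConfig 3 L (Matrix.specialUnitaryGroup (Fin 2) ℂ), (∑ e : Edge 3 L, w e * (fundamentalLatticeRep 2).riemannDist (Q e) (y e) ^ 2) ≤ (∑ e : Edge 3 L, w e * (fundamentalLatticeRep 2).riemannDist (Q e) (Q' e) ^ 2) →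
      (∑ n : Edge 3 L × NoiseIdx (fundamentalLatticeRep 2).N, (w n.1)⁻¹ * (fderiv ℝ f (coords y) (fun q : Edge 3 L × Fin (fundamentalLatticeRep 2).N × Fin (fundamentalLatticeRep 2).N × Bool => if n.1 = q.1 then (fun z : ℂ => if q.2.2.2 then z.im else z.re) (((Real.sqrt 2 : ℂ) • ((fundamentalLatticeRep 2).lieProj (noiseDir n.2) * (fundamentalLatticeRep 2).ρ (y q.1))) q.2.1 q.2.2.1) else 0)) ^ 2) ≤ σ2) →
      |f (coords Q') - f (coords Q)| ≤ Real.sqrt (σ2 / 2) * Real.sqrt (∑ e : Edge 3 L, w e * (fundamentalLatticeRep 2).riemannDist (Q e) (Q' e) ^ 2) := by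
  intro coords hΓ
  classical
  have hlog : ∀ e : Edge 3 L, ∃ X : Matrix (Fin (fundamentalLatticeRep 2).N) (Fin (fundamentalLatticeRep 2).N) ℂ, X ∈ (fundamentalLatticeRep 2).lieAlg ∧
      NormedSpace.exp X * (fundamentalLatticeRep 2).ρ (Q e) = (fundamentalLatticeRep 2).ρ (Q' e) ∧
      Real.sqrt (hsForm (fundamentalLatticeRep 2).N X X) = (fundamentalLatticeRep 2).riemannDist (Q e) (Q' e) := fun e =>
    exists_mem_lieAlg_exp_mul_eq_sqrt_hsForm_eq_riemannDist (Q e) (Q' e)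
  choose X hXmem hXexp hXnorm using hlog
  have hXh : ∀ e, (X e)ᴴ = -(X e) := fun e => by
    rw [← Matrix.star_eq_conjTranspose]; exact (fundamentalLatticeRep 2).star_eq_neg_of_mem_lieAlg (hXmem e)
  have hX0 : ∀ e, (X e).trace = 0 := fun e => trace_eq_zero_of_mem_lieAlg_two (hXmem e)
  have hsq : ∀ e, hsForm (fundamentalLatticeRep 2).N (X e) (X e) = (fundamentalLatticeRep 2).riemannDist (Q e) (Q' e) ^ 2 := fun e => by
    rw [← hXnorm e, Real.sq_sqrt (hsForm_self_nonneg _)]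
  have hdist : ∑ e : Edge 3 L, w e * hsForm (fundamentalLatticeRep 2).N (X e) (X e) = (∑ e : Edge 3 L, w e * (fundamentalLatticeRep 2).riemannDist (Q e) (Q' e) ^ 2) :=
    Finset.sum_congr rfl fun e _ => by rw [hsq e]
  have hD0 : 0 ≤ (∑ e : Edge 3 L, w e * (fundamentalLatticeRep 2).riemannDist (Q e) (Q' e) ^ 2) := Finset.sum_nonneg fun e _ => mul_nonneg (hw e).le (sq_nonneg _)
  -- the product geodesic
  set γ : ℝ → GaugeConfig 3 L (Matrix.specialUnitaryGroup (Fin 2) ℂ) := fun s e =>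
    SUNBakryEmery.expSU (N := 2) (Y := Matrix.of fun i j : Fin 2 => X e i j) (hXh e) (hX0 e) s * Q e with hγ
  have hγcoe : ∀ s e, (fundamentalLatticeRep 2).ρ (γ s e) = NormedSpace.exp (s • X e) * (fundamentalLatticeRep 2).ρ (Q e) := fun s e => rfl
  have hγ0 : γ 0 = Q := by
    funext e; apply Subtype.ext
    change NormedSpace.exp ((0 : ℝ) • X e) * (fundamentalLatticeRep 2).ρ (Q e) = (fundamentalLatticeRep 2).ρ (Q e)
    rw [zero_smul, NormedSpace.exp_zero, Matrix.one_mul]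
  have hγ1 : γ 1 = Q' := by
    funext e; apply Subtype.ext
    change NormedSpace.exp ((1 : ℝ) • X e) * (fundamentalLatticeRep 2).ρ (Q e) = (fundamentalLatticeRep 2).ρ (Q' e)
    rw [one_smul, hXexp e]
  -- coordinates of matrix configurations, the path in coordinates and its derivative
  set COf : (Edge 3 L → Matrix (Fin (fundamentalLatticeRep 2).N) (Fin (fundamentalLatticeRep 2).N) ℂ) → (Edge 3 L × Fin 2 × Fin 2 × Bool → ℝ) := fun Mc q =>
    (fun z : ℂ => if q.2.2.2 then z.im else z.re) (Mc q.1 q.2.1 q.2.2.1) with hCOf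
  have hCOadd : ∀ M₁ M₂, COf (M₁ + M₂) = COf M₁ + COf M₂ := by
    intro M₁ M₂; funext q; obtain ⟨e, a, b, flag⟩ := q
    cases flag
    · change ((M₁ e a b) + (M₂ e a b)).re = (M₁ e a b).re + (M₂ e a b).re
      exact Complex.add_re _ _
    · change ((M₁ e a b) + (M₂ e a b)).im = (M₁ e a b).im + (M₂ e a b).im
      exact Complex.add_im _ _
  have hCOsmul : ∀ (t : ℝ) M₁, COf (t • M₁) = t • COf M₁ := by
    intro t M₁; funext q; obtain ⟨e, a, b, flag⟩ := q
    cases flag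
    · change (t • (M₁ e a b)).re = t * (M₁ e a b).re
      rw [Complex.smul_re, smul_eq_mul]
    · change (t • (M₁ e a b)).im = t * (M₁ e a b).im
      rw [Complex.smul_im, smul_eq_mul]
  let COl : (Edge 3 L → Matrix (Fin (fundamentalLatticeRep 2).N) (Fin (fundamentalLatticeRep 2).N) ℂ) →ₗ[ℝ] (Edge 3 L × Fin 2 × Fin 2 × Bool → ℝ) := { toFun := COf, map_add' := hCOadd, map_smul' := hCOsmul }
  let CO : (Edge 3 L → Matrix (Fin (fundamentalLatticeRep 2).N) (Fin (fundamentalLatticeRep 2).N) ℂ) →L[ℝ] (Edge 3 L × Fin 2 × Fin 2 × Bool → ℝ) := LinearMap.toContinuousLinearMap COl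
  have hCO : ∀ Mc, CO Mc = COf Mc := fun _ => rfl
  set P : ℝ → (Edge 3 L → Matrix (Fin (fundamentalLatticeRep 2).N) (Fin (fundamentalLatticeRep 2).N) ℂ) := fun s e => NormedSpace.exp (s • X e) * (fundamentalLatticeRep 2).ρ (Q e) with hP
  set P' : ℝ → (Edge 3 L → Matrix (Fin (fundamentalLatticeRep 2).N) (Fin (fundamentalLatticeRep 2).N) ℂ) := fun s e => X e * NormedSpace.exp (s • X e) * (fundamentalLatticeRep 2).ρ (Q e) with hP'
  have hcoP : ∀ s, coords (γ s) = CO (P s) := fun s => by rw [hCO]; funext q; rfl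
  have hPd : ∀ s, HasDerivAt P (P' s) s := fun s =>
    hasDerivAt_pi.2 fun e => (hasDerivAt_exp_smul_const' (𝕂 := ℝ) (X e) s).mul_const _
  have hφd : ∀ s, HasDerivAt (fun s => f (coords (γ s))) (fderiv ℝ f (CO (P s)) (CO (P' s))) s := by
    intro s
    have h := (hf (CO (P s))).hasFDerivAt.comp_hasDerivAt s (CO.hasFDerivAt.comp_hasDerivAt s (hPd s))
    have heq : (fun s => f (coords (γ s))) = f ∘ (⇑CO) ∘ P := by funext s; simp only [Function.comp_apply, hcoP]
    rw [heq]; exact h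
  have hbound : ∀ s ∈ Set.Icc (0 : ℝ) 1, |fderiv ℝ f (CO (P s)) (CO (P' s))| ≤ Real.sqrt (σ2 / 2) * Real.sqrt (∑ e : Edge 3 L, w e * (fundamentalLatticeRep 2).riemannDist (Q e) (Q' e) ^ 2) := by
    intro s hs01
    -- `γ_s` stays in the `d_w`-ball
    have hball : (∑ e : Edge 3 L, w e * (fundamentalLatticeRep 2).riemannDist (Q e) (γ s e) ^ 2) ≤ (∑ e : Edge 3 L, w e * (fundamentalLatticeRep 2).riemannDist (Q e) (Q' e) ^ 2) := by
      have hs2 : s ^ 2 ≤ 1 := by have := hs01.1; have := hs01.2; nlinarith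
      calc (∑ e : Edge 3 L, w e * (fundamentalLatticeRep 2).riemannDist (Q e) (γ s e) ^ 2) ≤ ∑ e : Edge 3 L, w e * (s ^ 2 * hsForm (fundamentalLatticeRep 2).N (X e) (X e)) :=
            Finset.sum_le_sum fun e _ => mul_le_mul_of_nonneg_left (riemannDist_expSU_mul_sq_le (Q e) (hXmem e) (hXh e) (hX0 e) s) (hw e).le
        _ = s ^ 2 * (∑ e : Edge 3 L, w e * (fundamentalLatticeRep 2).riemannDist (Q e) (Q' e) ^ 2) := by
            rw [← hdist, Finset.mul_sum]; exact Finset.sum_congr rfl fun e _ => by ring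
        _ ≤ 1 * (∑ e : Edge 3 L, w e * (fundamentalLatticeRep 2).riemannDist (Q e) (Q' e) ^ 2) := mul_le_mul_of_nonneg_right hs2 hD0
        _ = (∑ e : Edge 3 L, w e * (fundamentalLatticeRep 2).riemannDist (Q e) (Q' e) ^ 2) := one_mul _
    have hv : CO (P' s) = fun q : Edge 3 L × Fin (fundamentalLatticeRep 2).N × Fin (fundamentalLatticeRep 2).N × Bool => (fun z : ℂ => if q.2.2.2 then z.im else z.re)
        ((X q.1 * (fundamentalLatticeRep 2).ρ (γ s q.1)) q.2.1 q.2.2.1) := by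
      rw [hCO]; funext q
      simp only [hCOf, hP', hγcoe, Matrix.mul_assoc]
    have hCS := frame_cauchySchwarz_two_weighted (L := L) (γ s) X hXmem w hw (fderiv ℝ f (CO (P s)))
    have hle : (∑ n : Edge 3 L × NoiseIdx (fundamentalLatticeRep 2).N, (w n.1)⁻¹ * (fderiv ℝ f (CO (P s)) (fun q : Edge 3 L × Fin (fundamentalLatticeRep 2).N × Fin (fundamentalLatticeRep 2).N × Bool => if n.1 = q.1 then (fun z : ℂ => if q.2.2.2 then z.im else z.re) (((Real.sqrt 2 : ℂ) • ((fundamentalLatticeRep 2).lieProj (noiseDir n.2) * (fundamentalLatticeRep 2).ρ (γ s q.1))) q.2.1 q.2.2.1) else 0)) ^ 2) ≤ σ2 := by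
      rw [← hcoP]; exact hΓ (γ s) hball
    have hsq2 : (fderiv ℝ f (CO (P s)) (CO (P' s))) ^ 2 ≤ (∑ e : Edge 3 L, w e * (fundamentalLatticeRep 2).riemannDist (Q e) (Q' e) ^ 2) / 2 * σ2 := by
      rw [hv, ← hdist]
      exact hCS.trans (mul_le_mul_of_nonneg_left hle (by rw [hdist]; positivity))
    have hσ0 : 0 ≤ σ2 := le_trans (Finset.sum_nonneg fun n _ => mul_nonneg (inv_nonneg.2 (hw n.1).le) (sq_nonneg _)) hle
    calc |fderiv ℝ f (CO (P s)) (CO (P' s))| = Real.sqrt ((fderiv ℝ f (CO (P s)) (CO (P' s))) ^ 2) := (Real.sqrt_sq_eq_abs _).symm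
      _ ≤ Real.sqrt ((∑ e : Edge 3 L, w e * (fundamentalLatticeRep 2).riemannDist (Q e) (Q' e) ^ 2) / 2 * σ2) := Real.sqrt_le_sqrt hsq2
      _ = Real.sqrt (σ2 / 2) * Real.sqrt (∑ e : Edge 3 L, w e * (fundamentalLatticeRep 2).riemannDist (Q e) (Q' e) ^ 2) := by
          rw [← Real.sqrt_mul (by positivity : (0:ℝ) ≤ σ2 / 2)]
          congr 1; ring
  have hMV := norm_image_sub_le_of_norm_deriv_le_segment_01' (f := fun s => f (coords (γ s)))
    (f' := fun s => fderiv ℝ f (CO (P s)) (CO (P' s))) (fun s _ => (hφd s).hasDerivWithinAt)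
    (fun s hs => by rw [Real.norm_eq_abs]; exact hbound s (Set.Ico_subset_Icc_self hs))
  rw [Real.norm_eq_abs] at hMV
  simpa only [hγ0, hγ1] using hMV

/-- ★★ **Weighted localised G44.**  If `w > 0`, `f` is differentiable and `|f(coords Q') − f(coords V)| ≤ L_f·d_w(V,Q')` for all `Q'` with
`d_w(V,Q') < δ` (some `δ > 0`), then `Γ^(1/w)(f)(V) = Σ_n w_(n.1)⁻¹ (W_n f)²(coords V) ≤ 2L_f²` (test along the flow generated by the
`w`-DUAL gradient `X_e = Σ_ν √2 w_e⁻¹ W_(e,ν)f 𝐩E_ν`, for small times). [cite: BakryGentilLedoux2014, §1.11 and (3.2.4)] -/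
theorem wcarre_le_two_mul_sq_of_local_wlipschitz (V : GaugeConfig 3 L (Matrix.specialUnitaryGroup (Fin 2) ℂ)) (w : Edge 3 L → ℝ) (hw : ∀ e, 0 < w e)
    {f : (Edge 3 L × Fin 2 × Fin 2 × Bool → ℝ) → ℝ} (hf : Differentiable ℝ f) {Lf : ℝ} (hLf : 0 ≤ Lf) :
    let coords : GaugeConfig 3 L (Matrix.specialUnitaryGroup (Fin 2) ℂ) → (Edge 3 L × Fin 2 × Fin 2 × Bool → ℝ) :=
      fun V q => (fun z : ℂ => if q.2.2.2 then z.im else z.re)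
        ((fundamentalRep (Fin 2) (V q.1) : Matrix (Fin 2) (Fin 2) ℂ) q.2.1 q.2.2.1)
    (∃ δ > 0, ∀ Q' : GaugeConfig 3 L (Matrix.specialUnitaryGroup (Fin 2) ℂ), Real.sqrt (∑ e : Edge 3 L, w e * (fundamentalLatticeRep 2).riemannDist (V e) (Q' e) ^ 2) < δ → |f (coords Q') - f (coords V)| ≤ Lf * Real.sqrt (∑ e : Edge 3 L, w e * (fundamentalLatticeRep 2).riemannDist (V e) (Q' e) ^ 2)) →
    (∑ n : Edge 3 L × NoiseIdx (fundamentalLatticeRep 2).N, (w n.1)⁻¹ * (fderiv ℝ f (coords V) (fun q : Edge 3 L × Fin (fundamentalLatticeRep 2).N × Fin (fundamentalLatticeRep 2).N × Bool => if n.1 = q.1 then (fun z : ℂ => if q.2.2.2 then z.im else z.re) (((Real.sqrt 2 : ℂ) • ((fundamentalLatticeRep 2).lieProj (noiseDir n.2) * (fundamentalLatticeRep 2).ρ (V q.1))) q.2.1 q.2.2.1) else 0)) ^ 2) ≤ 2 * Lf ^ 2 := by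
  intro coords hlip
  obtain ⟨δ, hδ, hlip⟩ := hlip
  classical
  set D : Edge 3 L × NoiseIdx (fundamentalLatticeRep 2).N → ℝ := fun n => fderiv ℝ f (coords V) (fun q : Edge 3 L × Fin (fundamentalLatticeRep 2).N × Fin (fundamentalLatticeRep 2).N × Bool => if n.1 = q.1 then (fun z : ℂ => if q.2.2.2 then z.im else z.re) (((Real.sqrt 2 : ℂ) • ((fundamentalLatticeRep 2).lieProj (noiseDir n.2) * (fundamentalLatticeRep 2).ρ (V q.1))) q.2.1 q.2.2.1) else 0) with hD
  show ∑ n, (w n.1)⁻¹ * D n ^ 2 ≤ 2 * Lf ^ 2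
  set G : ℝ := ∑ n, (w n.1)⁻¹ * D n ^ 2 with hGdef
  have hwi : ∀ e, 0 ≤ (w e)⁻¹ := fun e => inv_nonneg.2 (hw e).le
  have hG0 : 0 ≤ G := Finset.sum_nonneg fun n _ => mul_nonneg (hwi n.1) (sq_nonneg _)
  -- the `w`-dual gradient direction
  set X : Edge 3 L → Matrix (Fin (fundamentalLatticeRep 2).N) (Fin (fundamentalLatticeRep 2).N) ℂ := fun e =>
    ∑ m : NoiseIdx (fundamentalLatticeRep 2).N, (((w e)⁻¹ * D (e, m)) * Real.sqrt 2) • (fundamentalLatticeRep 2).lieProj (noiseDir m) with hXdef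
  have hXmem : ∀ e, X e ∈ (fundamentalLatticeRep 2).lieAlg := fun e =>
    Submodule.sum_mem _ fun m _ => (fundamentalLatticeRep 2).lieAlg.smul_mem _ ((fundamentalLatticeRep 2).lieProj_mem _)
  have hXh : ∀ e, (X e)ᴴ = -(X e) := fun e => by
    rw [← Matrix.star_eq_conjTranspose]; exact (fundamentalLatticeRep 2).star_eq_neg_of_mem_lieAlg (hXmem e)
  have hX0 : ∀ e, (X e).trace = 0 := fun e => trace_eq_zero_of_mem_lieAlg_two (hXmem e)
  have hXproj : ∀ e, X e = (fundamentalLatticeRep 2).lieProj (∑ m : NoiseIdx (fundamentalLatticeRep 2).N, (((w e)⁻¹ * D (e, m)) * Real.sqrt 2) • noiseDir m) := fun e => by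
    rw [map_sum]; simp_rw [map_smul]; rfl
  have hXnorm : ∑ e : Edge 3 L, w e * hsForm (fundamentalLatticeRep 2).N (X e) (X e) ≤ 2 * G := by
    calc ∑ e : Edge 3 L, w e * hsForm (fundamentalLatticeRep 2).N (X e) (X e)
        ≤ ∑ e : Edge 3 L, w e * ∑ m : NoiseIdx (fundamentalLatticeRep 2).N, (((w e)⁻¹ * D (e, m)) * Real.sqrt 2) ^ 2 :=
          Finset.sum_le_sum fun e _ => mul_le_mul_of_nonneg_left
            (by rw [hXproj, ← hsForm_sum_smul_noiseDir_self]; exact hsForm_lieProj_self_le _ _) (hw e).le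
      _ = 2 * G := by
          rw [hGdef]
          conv_rhs => rw [Fintype.sum_prod_type, Finset.mul_sum]
          refine Finset.sum_congr rfl fun e _ => ?_
          rw [Finset.mul_sum, Finset.mul_sum]
          refine Finset.sum_congr rfl fun m _ => ?_
          have hwe : (w e) * (w e)⁻¹ = 1 := mul_inv_cancel₀ (hw e).ne'
          rw [mul_pow, mul_pow, Real.sq_sqrt (by norm_num : (0:ℝ) ≤ 2)]
          calc w e * (((w e)⁻¹) ^ 2 * D (e, m) ^ 2 * 2) = (w e * (w e)⁻¹) * ((w e)⁻¹ * D (e, m) ^ 2 * 2) := by ring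
            _ = 2 * ((w (e, m).1)⁻¹ * D (e, m) ^ 2) := by rw [hwe]; ring
  -- the flow along `X` and the derivative of `f ∘ coords` along it at `s = 0`
  set γ : ℝ → GaugeConfig 3 L (Matrix.specialUnitaryGroup (Fin 2) ℂ) := fun s e =>
    SUNBakryEmery.expSU (N := 2) (Y := Matrix.of fun i j : Fin 2 => X e i j) (hXh e) (hX0 e) s * V e with hγ
  have hγ0 : γ 0 = V := by
    funext e; apply Subtype.ext
    change NormedSpace.exp ((0 : ℝ) • X e) * (fundamentalLatticeRep 2).ρ (V e) = (fundamentalLatticeRep 2).ρ (V e)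
    rw [zero_smul, NormedSpace.exp_zero, Matrix.one_mul]
  have hder : HasDerivAt (fun s => f (coords (γ s))) (fderiv ℝ f (coords (γ 0))
      (fun q : Edge 3 L × Fin 2 × Fin 2 × Bool => (fun z : ℂ => if q.2.2.2 then z.im else z.re)
        ((X q.1 * (fundamentalLatticeRep 2).ρ (γ 0 q.1)) q.2.1 q.2.2.1))) 0 :=
    hasDerivAt_comp_coords_prodFlow_two V X hXh hX0 hf 0
  have hvec : (fun q : Edge 3 L × Fin 2 × Fin 2 × Bool => (fun z : ℂ => if q.2.2.2 then z.im else z.re)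
      ((X q.1 * (fundamentalLatticeRep 2).ρ (γ 0 q.1)) q.2.1 q.2.2.1)) =
      ∑ n : Edge 3 L × NoiseIdx (fundamentalLatticeRep 2).N, ((w n.1)⁻¹ * D n) • (fun q : Edge 3 L × Fin (fundamentalLatticeRep 2).N × Fin (fundamentalLatticeRep 2).N × Bool => if n.1 = q.1 then (fun z : ℂ => if q.2.2.2 then z.im else z.re) (((Real.sqrt 2 : ℂ) • ((fundamentalLatticeRep 2).lieProj (noiseDir n.2) * (fundamentalLatticeRep 2).ρ (V q.1))) q.2.1 q.2.2.1) else 0) := by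
    rw [hγ0]; exact coordVec_sum_smul_lieProj_two V (fun n => (w n.1)⁻¹ * D n)
  set Λ : (Edge 3 L × Fin (fundamentalLatticeRep 2).N × Fin (fundamentalLatticeRep 2).N × Bool → ℝ) →L[ℝ] ℝ := fderiv ℝ f (coords V) with hΛ
  have hval : fderiv ℝ f (coords (γ 0)) (fun q : Edge 3 L × Fin 2 × Fin 2 × Bool => (fun z : ℂ => if q.2.2.2 then z.im else z.re)
      ((X q.1 * (fundamentalLatticeRep 2).ρ (γ 0 q.1)) q.2.1 q.2.2.1)) = G := by
    rw [hvec, hγ0]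
    change Λ (∑ n : Edge 3 L × NoiseIdx (fundamentalLatticeRep 2).N, ((w n.1)⁻¹ * D n) • (fun q : Edge 3 L × Fin (fundamentalLatticeRep 2).N × Fin (fundamentalLatticeRep 2).N × Bool => if n.1 = q.1 then (fun z : ℂ => if q.2.2.2 then z.im else z.re) (((Real.sqrt 2 : ℂ) • ((fundamentalLatticeRep 2).lieProj (noiseDir n.2) * (fundamentalLatticeRep 2).ρ (V q.1))) q.2.1 q.2.2.1) else 0)) = G
    rw [map_sum, hGdef]
    refine Finset.sum_congr rfl fun n _ => ?_
    rw [map_smul, smul_eq_mul, sq]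
    show (w n.1)⁻¹ * D n * D n = (w n.1)⁻¹ * (D n * D n)
    ring
  replace hder := hder.congr_deriv hval
  have hC0 : 0 ≤ Lf * Real.sqrt (2 * G) := by positivity
  -- the flow stays `d_w`-close to `V`
  have hlipflow : ∀ᶠ s in 𝓝 (0 : ℝ), ‖f (coords (γ s)) - f (coords (γ 0))‖ ≤ Lf * Real.sqrt (2 * G) * ‖s - 0‖ := by
    have hpos : 0 < δ / (Real.sqrt (2 * G) + 1) := by positivity
    rw [Metric.eventually_nhds_iff]
    refine ⟨δ / (Real.sqrt (2 * G) + 1), hpos, fun s hs => ?_⟩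
    rw [Real.dist_eq, sub_zero] at hs
    rw [sub_zero, Real.norm_eq_abs, Real.norm_eq_abs, hγ0]
    have h2 : Real.sqrt (∑ e : Edge 3 L, w e * (fundamentalLatticeRep 2).riemannDist (V e) (γ s e) ^ 2) ≤ |s| * Real.sqrt (2 * G) := by
      have h1 : (∑ e : Edge 3 L, w e * (fundamentalLatticeRep 2).riemannDist (V e) (γ s e) ^ 2) ≤ s ^ 2 * (2 * G) :=
        calc (∑ e : Edge 3 L, w e * (fundamentalLatticeRep 2).riemannDist (V e) (γ s e) ^ 2) ≤ ∑ e : Edge 3 L, w e * (s ^ 2 * hsForm (fundamentalLatticeRep 2).N (X e) (X e)) :=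
              Finset.sum_le_sum fun e _ => mul_le_mul_of_nonneg_left (riemannDist_expSU_mul_sq_le (V e) (hXmem e) (hXh e) (hX0 e) s) (hw e).le
          _ = s ^ 2 * ∑ e : Edge 3 L, w e * hsForm (fundamentalLatticeRep 2).N (X e) (X e) := by
              rw [Finset.mul_sum]; exact Finset.sum_congr rfl fun e _ => by ring
          _ ≤ s ^ 2 * (2 * G) := mul_le_mul_of_nonneg_left hXnorm (sq_nonneg s)
      calc Real.sqrt (∑ e : Edge 3 L, w e * (fundamentalLatticeRep 2).riemannDist (V e) (γ s e) ^ 2) ≤ Real.sqrt (s ^ 2 * (2 * G)) := Real.sqrt_le_sqrt h1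
        _ = |s| * Real.sqrt (2 * G) := by rw [Real.sqrt_mul (sq_nonneg s), Real.sqrt_sq_eq_abs]
    have hclose : Real.sqrt (∑ e : Edge 3 L, w e * (fundamentalLatticeRep 2).riemannDist (V e) (γ s e) ^ 2) < δ := by
      have hsG : |s| * Real.sqrt (2 * G) ≤ |s| * (Real.sqrt (2 * G) + 1) := mul_le_mul_of_nonneg_left (by linarith) (abs_nonneg s)
      have hlt : |s| * (Real.sqrt (2 * G) + 1) < δ := by
        have := (lt_div_iff₀ (by positivity : (0:ℝ) < Real.sqrt (2 * G) + 1)).1 hs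
        linarith
      linarith
    have h1 := hlip (γ s) hclose
    calc |f (coords (γ s)) - f (coords V)| ≤ Lf * Real.sqrt (∑ e : Edge 3 L, w e * (fundamentalLatticeRep 2).riemannDist (V e) (γ s e) ^ 2) := h1
      _ ≤ Lf * (|s| * Real.sqrt (2 * G)) := mul_le_mul_of_nonneg_left h2 hLf
      _ = Lf * Real.sqrt (2 * G) * |s| := by ring
  have hGle : G ≤ Lf * Real.sqrt (2 * G) := by
    have h := hder.le_of_lip' hC0 hlipflow
    rw [Real.norm_eq_abs, abs_of_nonneg hG0] at h
    exact h
  by_contra hcon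
  push Not at hcon
  have hGpos : 0 < G := lt_of_le_of_lt (by positivity) hcon
  have hsq : G ^ 2 ≤ Lf ^ 2 * (2 * G) := by
    calc G ^ 2 ≤ (Lf * Real.sqrt (2 * G)) ^ 2 := pow_le_pow_left₀ hG0 hGle 2
      _ = Lf ^ 2 * (2 * G) := by rw [mul_pow, Real.sq_sqrt (by positivity)]
  nlinarith

end Local

end Summit.QuantumFields.YangMills.Theorems.ColdStartUniversality
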